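import Summits.Parity.GeneralizedHardyLittlewood.Theorems.LiouvilleShiftedTablesSieveToMAvgTypeIISum
import Summits.Parity.GeneralizedHardyLittlewood.Theorems.LiouvilleShiftedTablesEngineToPairsSieveTriple

/-!
# Sieve glue for `SieveToMAvg`, part 7a: Type I₂ — the hypothesis, hyperbolic sums, counting

Support file for item stmt-Parity-14274 (route `LiouvilleShiftedTables`).  The crux `TypeI2Dilated`
controls, at a fixed scale `X`, the sums

  `D(q, r; S, y) = ∑_{s ≤ S} ∑_{n ≤ y/(sr), rsn ≡ h (q)} λ(rsn − h)`

on `ℓ¹`-average over `q ≤ X^ρ`, `r ≤ R` (`HypI2`).  Differences of four such sums carve out the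
regions `{a < s ≤ b, L < rsn ≤ M}` exactly (`regionSum_eq`), which is how the non-Type-II box
tuples are fed to the crux in parts 7b–7c.  We also record the elementary count of the integers of an
interval in one residue class, summed over the moduli `q ≤ Q` coprime to `h`
(`sum_moduli_card_filter_le`: for `(q, h) = 1` the congruence `rsn ≡ h (q)` has at most one solution
class in `n`).
-/

namespace Summit.Parity.GeneralizedHardyLittlewood.Theorems.SieveToMAvg

open Finset Real
open scoped ArithmeticFunction.zeta ArithmeticFunction.sigma
open Literature.NumberTheory.Sieve.BFI

/-! ### The Type-I₂ hypothesis at a fixed scale -/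

/-- `TypeI2Dilated` at the fixed shift `c`, class `w`, exponent `ρ`, saving `A`, constant `C` and
scale `X` (the body of the crux after `∃ ρ … ∃ C x₀ ∀ x ≥ x₀ ∀ w`). [folklore] -/
def HypI2 (X : ℝ) (c : ℤ) (w : ℕ) (ρ A C : ℝ) : Prop :=
  ∀ R S y : ℝ, 1 ≤ R → R ≤ X ^ ρ → 0 ≤ S → S * R ≤ X ^ (1 / 2 + ρ) → 0 ≤ y → y ≤ X →
    (∑ q ∈ Icc 1 ⌊X ^ ρ⌋₊, ∑ r ∈ Icc 1 ⌊R⌋₊,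
      |∑ s ∈ Icc 1 ⌊S⌋₊, ∑ n ∈ (Icc 1 ⌊y / (s * r)⌋₊).filter (fun n : ℕ => r * s * n ≡ w [MOD q]),
        (ArithmeticFunction.liouville (Int.toNat ((r : ℤ) * s * n + c)) : ℝ)|) ≤ C * X / Real.log X ^ A

/-- The hyperbolic sum `D(q, r; S, y) = ∑_{s ≤ S} ∑_{n ≤ y/(sr), rsn ≡ h (q)} λ(rsn − h)`. [folklore] -/
noncomputable def Dsum (h q r : ℕ) (S y : ℝ) : ℝ :=
  ∑ s ∈ Icc 1 ⌊S⌋₊, ∑ n ∈ (Icc 1 ⌊y / (s * r)⌋₊).filter (fun n : ℕ => r * s * n ≡ h [MOD q]),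
    lamW h (r * s * n)

/-- The summand of the crux with `c = −h` is `λ(rsn − h)`. [folklore] -/
theorem liouville_toNat_eq_lamW (h r s n : ℕ) :
    (ArithmeticFunction.liouville (Int.toNat ((r : ℤ) * s * n + -(h : ℤ))) : ℝ) = lamW h (r * s * n) := by
  unfold lamW; push_cast; ring_nf

/-- **`HypI2` in terms of `Dsum`**: `∑_{q ≤ X^ρ} ∑_{r ≤ R} |D(q, r; S, y)| ≤ C X/(log X)^A`. [folklore] -/
theorem HypI2.sum_abs_Dsum_le {X : ℝ} {h : ℕ} {ρ A C : ℝ} (hyp : HypI2 X (-(h : ℤ)) h ρ A C)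
    {R S y : ℝ} (hR1 : 1 ≤ R) (hR : R ≤ X ^ ρ) (hS : 0 ≤ S) (hSR : S * R ≤ X ^ (1 / 2 + ρ))
    (hy0 : 0 ≤ y) (hy : y ≤ X) :
    ∑ q ∈ Icc 1 ⌊X ^ ρ⌋₊, ∑ r ∈ Icc 1 ⌊R⌋₊, |Dsum h q r S y| ≤ C * X / Real.log X ^ A := by
  have := hyp R S y hR1 hR hS hSR hy0 hy
  simp only [liouville_toNat_eq_lamW] at this
  exact this

/-! ### The trivial count and its sum over the moduli -/

/-- Integers of `(a, b]` (naturals `Ioc a b`, `a ≤ b`) in one residue class mod `q ≥ 1`: at most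
`(b − a)/q + 1` (`Nat.Ioc_filter_modEq_card`). [folklore] -/
theorem card_Ioc_filter_modEq_le {q : ℕ} (hq : 0 < q) {a b : ℕ} (hab : a ≤ b) (n₀ : ℕ) :
    (((Ioc a b).filter (fun n => n ≡ n₀ [MOD q])).card : ℝ) ≤ ((b : ℝ) - a) / q + 1 := by
  have h := Nat.Ioc_filter_modEq_card a b hq n₀
  have hq0 : (0 : ℚ) < q := by exact_mod_cast hq
  set B : ℚ := ((b : ℚ) - n₀) / q with hB
  set A : ℚ := ((a : ℚ) - n₀) / q with hA
  have hBA : B - A = ((b : ℚ) - a) / q := by rw [hB, hA]; field_simp; ring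
  have hd : ((⌊B⌋ - ⌊A⌋ : ℤ) : ℚ) ≤ ((b : ℚ) - a) / q + 1 := by
    have h1 : ((⌊B⌋ : ℤ) : ℚ) ≤ B := Int.floor_le B
    have h2 : A < ((⌊A⌋ : ℤ) : ℚ) + 1 := Int.lt_floor_add_one A
    push_cast
    linarith
  have hpos : (0 : ℚ) ≤ ((b : ℚ) - a) / q + 1 := by
    have : (0 : ℚ) ≤ (b : ℚ) - a := by
      have : (a : ℚ) ≤ b := by exact_mod_cast hab
      linarith
    positivity
  have hQ : ((((Ioc a b).filter (fun n => n ≡ n₀ [MOD q])).card : ℤ) : ℚ) ≤ ((b : ℚ) - a) / q + 1 := by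
    rw [h]
    rcases le_total (⌊B⌋ - ⌊A⌋) 0 with hle | hle
    · rw [max_eq_right hle]; push_cast; exact hpos
    · rw [max_eq_left hle]; exact hd
  have hQ' : ((((Ioc a b).filter (fun n => n ≡ n₀ [MOD q])).card : ℕ) : ℚ) ≤ ((b : ℚ) - a) / q + 1 := by
    exact_mod_cast hQ
  have hR := (Rat.cast_le (K := ℝ)).2 hQ'
  push_cast at hR
  exact hR

/-- For `(q, h) = 1`, the congruence `m · n ≡ h (mod q)` in `n` has no solution unless `(m, q) = 1`,
and then its solutions form one class mod `q`. Hence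
`#{n ∈ (a, b] : m n ≡ h (q)} ≤ (b − a)/q + 1` (`q ≥ 1`, `a ≤ b`). [folklore] -/
theorem card_Ioc_filter_mul_modEq_le {q h : ℕ} (hq : 0 < q) (hqh : Nat.Coprime q h) (m : ℕ) {a b : ℕ}
    (hab : a ≤ b) :
    (((Ioc a b).filter (fun n => m * n ≡ h [MOD q])).card : ℝ) ≤ ((b : ℝ) - a) / q + 1 := by
  classical
  by_cases hsol : ∃ n₁, m * n₁ ≡ h [MOD q]
  · obtain ⟨n₁, hn₁⟩ := hsol
    -- `(m, q) = 1`, so `m` is cancellable: the solutions are `n ≡ n₁`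
    have hm : Nat.Coprime m q := by
      have h1 : Nat.gcd m q ∣ q := Nat.gcd_dvd_right m q
      have h2 : Nat.gcd m q ∣ h := (Nat.ModEq.dvd_iff hn₁ h1).1 (dvd_mul_of_dvd_left (Nat.gcd_dvd_left m q) n₁)
      exact Nat.Coprime.eq_one_of_dvd (Nat.Coprime.coprime_dvd_left h2 hqh.symm) h1
    have hsub : (Ioc a b).filter (fun n => m * n ≡ h [MOD q]) ⊆ (Ioc a b).filter (fun n => n ≡ n₁ [MOD q]) := by
      intro n hn
      rw [Finset.mem_filter] at hn ⊢
      refine ⟨hn.1, ?_⟩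
      exact Nat.ModEq.cancel_left_of_coprime (by simpa [Nat.coprime_comm] using hm) (hn.2.trans hn₁.symm)
    calc (((Ioc a b).filter (fun n => m * n ≡ h [MOD q])).card : ℝ)
        ≤ (((Ioc a b).filter (fun n => n ≡ n₁ [MOD q])).card : ℝ) := by exact_mod_cast Finset.card_le_card hsub
      _ ≤ ((b : ℝ) - a) / q + 1 := card_Ioc_filter_modEq_le hq hab n₁
  · have : (Ioc a b).filter (fun n => m * n ≡ h [MOD q]) = ∅ := by
      rw [Finset.filter_eq_empty_iff]
      exact fun n _ hn => hsol ⟨n, hn⟩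
    rw [this, Finset.card_empty, Nat.cast_zero]
    have hq0 : (0 : ℝ) < q := by exact_mod_cast hq
    have : (0 : ℝ) ≤ (b : ℝ) - a := by
      have : (a : ℝ) ≤ b := by exact_mod_cast hab
      linarith
    positivity

/-- **Summing the one-class count over the moduli**: for `m ≥ 1` and `a ≤ b`,
`∑_{q ≤ Q, (q,h)=1} #{n ∈ (a, b] : m n ≡ h (q)} ≤ (b − a) · ∑_{q≤Q} 1/q + Q`. [folklore] -/
theorem sum_moduli_card_filter_le (Q h m : ℕ) {a b : ℕ} (hab : a ≤ b) :
    ∑ q ∈ moduli Q h, (((Ioc a b).filter (fun n => m * n ≡ h [MOD q])).card : ℝ) ≤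
      ((b : ℝ) - a) * (∑ q ∈ Icc 1 Q, (q : ℝ)⁻¹) + Q := by
  have hs : moduli Q h ⊆ Icc 1 Q := Finset.filter_subset _ _
  calc ∑ q ∈ moduli Q h, (((Ioc a b).filter (fun n => m * n ≡ h [MOD q])).card : ℝ)
      ≤ ∑ q ∈ moduli Q h, (((b : ℝ) - a) / q + 1) := by
        refine Finset.sum_le_sum fun q hq => ?_
        obtain ⟨⟨hq1, -⟩, hqh⟩ := mem_moduli.1 hq
        exact card_Ioc_filter_mul_modEq_le (by omega) hqh m hab
    _ ≤ ∑ q ∈ Icc 1 Q, (((b : ℝ) - a) / q + 1) := by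
        refine Finset.sum_le_sum_of_subset_of_nonneg hs fun q _ _ => ?_
        have : (0 : ℝ) ≤ (b : ℝ) - a := by
          have : (a : ℝ) ≤ b := by exact_mod_cast hab
          linarith
        positivity
    _ = ((b : ℝ) - a) * (∑ q ∈ Icc 1 Q, (q : ℝ)⁻¹) + Q := by
        rw [Finset.sum_add_distrib, Finset.sum_const, Nat.card_Icc, Finset.mul_sum]
        simp [div_eq_mul_inv]

/-! ### Regions carved by four hyperbolic sums -/

/-- The inner sum of `Dsum` at height `y`: `g(y, s) = ∑_{n ≤ y/(sr), rsn ≡ h (q)} λ(rsn − h)`. [folklore] -/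
noncomputable def gInner (h q r : ℕ) (y : ℝ) (s : ℕ) : ℝ :=
  ∑ n ∈ (Icc 1 ⌊y / (s * r)⌋₊).filter (fun n : ℕ => r * s * n ≡ h [MOD q]), lamW h (r * s * n)

/-- `Dsum = ∑_{s ≤ S} gInner`. [folklore] -/
theorem Dsum_eq_sum_gInner (h q r : ℕ) (S y : ℝ) : Dsum h q r S y = ∑ s ∈ Icc 1 ⌊S⌋₊, gInner h q r y s := rfl

/-- The region sum `∑_{a < s ≤ b} ∑_{L < rsn ≤ M, rsn ≡ h (q)} λ(rsn − h)` (the `n`-range written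
through floors: `⌊L/(sr)⌋ < n ≤ ⌊M/(sr)⌋`). [folklore] -/
noncomputable def regionSum (h q r : ℕ) (a b L M : ℝ) : ℝ :=
  ∑ s ∈ Ioc ⌊a⌋₊ ⌊b⌋₊, ∑ n ∈ (Icc 1 ⌊M / (s * r)⌋₊).filter
    (fun n : ℕ => ⌊L / (s * r)⌋₊ < n ∧ r * s * n ≡ h [MOD q]), lamW h (r * s * n)

/-- **Carving a region by differencing**: for `a ≤ b`, `L ≤ M`,
`regionSum(a, b, L, M) = D(b, M) − D(a, M) − D(b, L) + D(a, L)`. [folklore] -/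
theorem regionSum_eq (h q r : ℕ) {a b L M : ℝ} (hab : a ≤ b) (hLM : L ≤ M) :
    regionSum h q r a b L M = Dsum h q r b M - Dsum h q r a M - Dsum h q r b L + Dsum h q r a L := by
  have hfl : ⌊a⌋₊ ≤ ⌊b⌋₊ := Nat.floor_le_floor hab
  simp only [Dsum_eq_sum_gInner]
  rw [Summit.Parity.GeneralizedHardyLittlewood.Theorems.EngineToPairs.Sieve.sum_Icc_one_eq_add_sum_Ioc hfl (gInner h q r M),
    Summit.Parity.GeneralizedHardyLittlewood.Theorems.EngineToPairs.Sieve.sum_Icc_one_eq_add_sum_Ioc hfl (gInner h q r L)]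
  have hinner : ∀ s ∈ Ioc ⌊a⌋₊ ⌊b⌋₊,
      (∑ n ∈ (Icc 1 ⌊M / (s * r)⌋₊).filter (fun n : ℕ => ⌊L / (s * r)⌋₊ < n ∧ r * s * n ≡ h [MOD q]),
        lamW h (r * s * n)) = gInner h q r M s - gInner h q r L s := by
    intro s _
    unfold gInner
    have hfl' : ⌊L / (s * r)⌋₊ ≤ ⌊M / (s * r)⌋₊ := by
      refine Nat.floor_le_floor ?_
      exact div_le_div_of_nonneg_right hLM (by positivity)
    rw [Finset.sum_filter, Finset.sum_filter, Finset.sum_filter]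
    have hzero : (∑ n ∈ Icc 1 ⌊L / (s * r)⌋₊,
        if ⌊L / (s * r)⌋₊ < n ∧ r * s * n ≡ h [MOD q] then lamW h (r * s * n) else 0) = 0 := by
      refine Finset.sum_eq_zero fun n hn => ?_
      rw [Finset.mem_Icc] at hn
      rw [if_neg]; intro h'; omega
    have hsame : (∑ n ∈ Ioc ⌊L / (s * r)⌋₊ ⌊M / (s * r)⌋₊,
        if ⌊L / (s * r)⌋₊ < n ∧ r * s * n ≡ h [MOD q] then lamW h (r * s * n) else 0) =
        ∑ n ∈ Ioc ⌊L / (s * r)⌋₊ ⌊M / (s * r)⌋₊,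
          if r * s * n ≡ h [MOD q] then lamW h (r * s * n) else 0 := by
      refine Finset.sum_congr rfl fun n hn => ?_
      rw [Finset.mem_Ioc] at hn
      by_cases hm : r * s * n ≡ h [MOD q]
      · rw [if_pos ⟨hn.1, hm⟩, if_pos hm]
      · rw [if_neg (fun h' => hm h'.2), if_neg hm]
    have hsplit : (∑ n ∈ Icc 1 ⌊M / (s * r)⌋₊,
        if ⌊L / (s * r)⌋₊ < n ∧ r * s * n ≡ h [MOD q] then lamW h (r * s * n) else 0) =
        (∑ n ∈ Icc 1 ⌊L / (s * r)⌋₊,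
          if ⌊L / (s * r)⌋₊ < n ∧ r * s * n ≡ h [MOD q] then lamW h (r * s * n) else 0) +
        ∑ n ∈ Ioc ⌊L / (s * r)⌋₊ ⌊M / (s * r)⌋₊,
          if ⌊L / (s * r)⌋₊ < n ∧ r * s * n ≡ h [MOD q] then lamW h (r * s * n) else 0 :=
      Summit.Parity.GeneralizedHardyLittlewood.Theorems.EngineToPairs.Sieve.sum_Icc_one_eq_add_sum_Ioc hfl' _
    have hsplit2 : (∑ n ∈ Icc 1 ⌊M / (s * r)⌋₊, if r * s * n ≡ h [MOD q] then lamW h (r * s * n) else 0) =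
        (∑ n ∈ Icc 1 ⌊L / (s * r)⌋₊, if r * s * n ≡ h [MOD q] then lamW h (r * s * n) else 0) +
        ∑ n ∈ Ioc ⌊L / (s * r)⌋₊ ⌊M / (s * r)⌋₊, if r * s * n ≡ h [MOD q] then lamW h (r * s * n) else 0 :=
      Summit.Parity.GeneralizedHardyLittlewood.Theorems.EngineToPairs.Sieve.sum_Icc_one_eq_add_sum_Ioc hfl' _
    linarith [hsplit, hzero, hsame, hsplit2]
  unfold regionSum
  rw [Finset.sum_congr rfl hinner, Finset.sum_sub_distrib]
  ring

/-- Membership in the `n`-range of `regionSum`: for `0 ≤ L`, `0 ≤ M` and `r, s ≥ 1`,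
`(1 ≤ n ≤ ⌊M/(sr)⌋ ∧ ⌊L/(sr)⌋ < n) ↔ (L < rsn ∧ rsn ≤ M)` (as reals). [folklore] -/
theorem mem_nRange_iff {r s n : ℕ} (hr : 0 < r) (hs : 0 < s) {L M : ℝ} (hL : 0 ≤ L) (hM : 0 ≤ M) :
    ((1 ≤ n ∧ n ≤ ⌊M / (s * r)⌋₊) ∧ ⌊L / (s * r)⌋₊ < n) ↔
      (L < (r : ℝ) * s * n ∧ (r : ℝ) * s * n ≤ M) := by
  have hsr : (0 : ℝ) < (s : ℝ) * r := by positivity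
  have e1 : n ≤ ⌊M / (s * r)⌋₊ ↔ (r : ℝ) * s * n ≤ M := by
    rw [Nat.le_floor_iff (by positivity), le_div_iff₀ hsr]
    constructor <;> intro h' <;> nlinarith
  have e2 : ⌊L / (s * r)⌋₊ < n ↔ L < (r : ℝ) * s * n := by
    rw [Nat.floor_lt (by positivity), div_lt_iff₀ hsr]
    constructor <;> intro h' <;> nlinarith
  constructor
  · rintro ⟨⟨-, h2⟩, h3⟩; exact ⟨e2.1 h3, e1.1 h2⟩
  · rintro ⟨h1, h2⟩
    refine ⟨⟨?_, e1.2 h2⟩, e2.2 h1⟩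
    by_contra h0
    have : n = 0 := by omega
    subst this
    simp at h1
    linarith

end Summit.Parity.GeneralizedHardyLittlewood.Theorems.SieveToMAvg
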